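import Summits.NavierStokesRegularity.FluidComputer.RiccatiSummationTools
import HarnessLib

/-!
# Fluid computer — support: the weighted summation behind the `Ḣ^{3/2}` Riccati inequality (Cheskidov–Zaya 2016,
# Thm. 2.2) in the tree's paraproduct shapes (pure bookkeeping on sequences of levels)

HONEST FRAMING (cell `pub-fluidc`, verbatim): *low prior, high value-of-information experiment on Tao's
machine paradigm; NOT a claim that NS blows up.* Support file (no fluid content): the SUMMATION STEP of the
dyadic Riccati inequality `d/dt ∑_q λ_q³ ‖u_q‖₂² ≲ (∑_q λ_q³ ‖u_q‖₂²)²` (Cheskidov–Zaya 2016, Thm. 2.2, the route to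
the OPTIMAL `Ḣ^{3/2}` blow-up rate `‖u(t)‖_{Ḣ^{3/2}} ≳ (T − t)^{−1/2}`, their Thm. 2.4), written for the tree's LOW-MODE
form of the block balance (`enorm_integral_inner_blockFn_convect_le_lowMode`, Cheskidov–Dai (3.6), as used in
`LevelTransferFloor.blockL2_sq_le_add_local`): the nonlinear term of the `j`-th block is bounded by
`a_j ∑_{|m|≤2} a_{j+m} T_{j+m} + s_j Q_j` with `T_l = paraT (2^· s) l = ∑_{l' ≤ l−3} 2^{l'} s_{l'}` (coarse strain) and
`Q_j = paraQ2 a (2^· a) j` (fine energy pairs). For sequences `a, s ≥ 0` on `ℤ` with the Bernstein relation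
`s_l ≤ C_B 2^{3l/2} a_l`, and with `y = ∑_j 8^j a_j²` (the `Ḃ^{3/2}_{2,2}` row) and `D = ∑_j 32^j a_j²` (the dissipation row
at this weight):

* (tools: `RiccatiSummationTools.tsum_shift_le_sqrt` / `paraT_weighted_le` / `tsum_tsum_reindex` and the tree's
  `Literature.Analysis.FunctionSpaces.tsum_mul_shift_le`);
* `lowHigh_weighted_le` — `∑_j 8^j a_j a_{j+m} T_{j+m} ≤ 2 C_B · y · D^{1/2}` for each `|m| ≤ 2`;
* `highHigh_weighted_le` — `∑_j 8^j s_j Q_j ≤ 2^{17} C_B · y · D^{1/2}`;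
* `riccati_summation` — together: `∑_j 8^j (a_j ∑_{|m|≤2} a_{j+m} T_{j+m} + s_j Q_j) ≤ 2^{18} C_B · y · D^{1/2}`, whence
  by Young `≤ ε D + 2^{34} C_B² ε⁻¹ y²` for the consumer (the viscous term `−ν ∑ 8^j S_j ≲ −ν D` absorbs `ε D`).

What remains for the `Ḣ^{3/2}` row itself (a successor's work, NOT done here): the time-differentiated weighted block
balance with truncation (as in the Cheskidov–Shvydkoy discharge), the ODE comparison `y' ≤ K ν⁻¹ y²`, and `y → ∞` at
`T` (from L20 by interpolation). 0 sorry; no definitions beyond local abbreviations; no named facts.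

## References

* A. Cheskidov, K. Zaya, *Lower bounds of potential blow-up solutions of the three-dimensional Navier–Stokes
  equations in Ḣ^{3/2}*, J. Math. Phys. 57 (2016) 023101 = arXiv:1503.01784, Lemma 2.1, Thm. 2.2.
  [CheskidovZaya2016]
* A. Cheskidov, M. Dai, §3.1 (3.6). [CheskidovDai2015]
-/

noncomputable section

open MeasureTheory Set Function Filter Topology Metric
open scoped ENNReal NNReal
open Literature.Analysis.FluidPDE Literature.Analysis.FunctionSpaces
open Summit.NavierStokesRegularity.FluidComputer.RiccatiSummationTools

namespace Summit.NavierStokesRegularity.FluidComputer.RiccatiSummation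

variable (a s : ℤ → ℝ≥0∞) (CB : ℝ≥0∞)

/-- **The low–high (coarse-strain) sum at weight `8^j`**: with `s_l ≤ C_B 2^{3l/2} a_l`, for every `|m| ≤ 2`,
`∑_j 8^j a_j a_{j+m} T_{j+m} ≤ 2 C_B · (∑_j 8^j a_j²) · (∑_j 32^j a_j²)^{1/2}`, `T = paraT (2^· s)`
(`paraT_weighted_le`, then Cauchy–Schwarz `tsum_mul_shift_le` between `2^{5j/2} a_j` and `2^{3(j+m)/2} a_{j+m}`).
[cite: CheskidovZaya2016, Thm. 2.2 (proof)] -/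
theorem lowHigh_weighted_le (hB : ∀ l : ℤ, s l ≤ CB * (2 : ℝ≥0∞) ^ ((3 / 2 : ℝ) * (l : ℝ)) * a l)
    (m : ℤ) (hm : -2 ≤ m) :
    ∑' j : ℤ, (2 : ℝ≥0∞) ^ ((3 : ℝ) * (j : ℝ)) *
        (a j * (a (j + m) * paraT (fun l' => (2 : ℝ≥0∞) ^ l' * s l') (j + m))) ≤
      2 * CB * (∑' j : ℤ, (2 : ℝ≥0∞) ^ ((3 : ℝ) * (j : ℝ)) * a j ^ 2) *
        (∑' j : ℤ, (2 : ℝ≥0∞) ^ ((5 : ℝ) * (j : ℝ)) * a j ^ 2) ^ (1 / 2 : ℝ) := by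
  have h2 : (2 : ℝ≥0∞) ≠ 0 := two_ne_zero
  have h2' : (2 : ℝ≥0∞) ≠ ⊤ := ENNReal.ofNat_ne_top
  set Y : ℝ≥0∞ := ∑' j : ℤ, (2 : ℝ≥0∞) ^ ((3 : ℝ) * (j : ℝ)) * a j ^ 2 with hY
  set D : ℝ≥0∞ := ∑' j : ℤ, (2 : ℝ≥0∞) ^ ((5 : ℝ) * (j : ℝ)) * a j ^ 2 with hD
  set x : ℤ → ℝ≥0∞ := fun k => (2 : ℝ≥0∞) ^ ((3 / 2 : ℝ) * (k : ℝ)) * a k with hx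
  set z : ℤ → ℝ≥0∞ := fun k => (2 : ℝ≥0∞) ^ ((5 / 2 : ℝ) * (k : ℝ)) * a k with hz
  have hx2 : ∑' k : ℤ, x k ^ 2 = Y := by
    refine tsum_congr fun k => ?_
    simp only [hx]
    rw [mul_pow, ← ENNReal.rpow_natCast ((2 : ℝ≥0∞) ^ _) 2, ← ENNReal.rpow_mul]
    congr 2; push_cast; ring
  have hz2 : ∑' k : ℤ, z k ^ 2 = D := by
    refine tsum_congr fun k => ?_
    simp only [hz]
    rw [mul_pow, ← ENNReal.rpow_natCast ((2 : ℝ≥0∞) ^ _) 2, ← ENNReal.rpow_mul]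
    congr 2; push_cast; ring
  -- the constant in front after `paraT_weighted_le`
  set K : ℝ≥0∞ := CB * (2 * ((2 : ℝ≥0∞) ^ ((m : ℝ) - 3) * Y ^ (1 / 2 : ℝ))) * (2 : ℝ≥0∞) ^ (-(3 / 2 : ℝ) * (m : ℝ))
    with hK
  -- termwise rewriting
  have hterm : ∀ j : ℤ, (2 : ℝ≥0∞) ^ ((3 : ℝ) * (j : ℝ)) *
      (a j * (a (j + m) * paraT (fun l' => (2 : ℝ≥0∞) ^ l' * s l') (j + m))) ≤ K * (z j * x (j + m)) := by
    intro j
    have hT := paraT_weighted_le a s CB hB (j + m)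
    have e : (2 : ℝ≥0∞) ^ ((3 : ℝ) * (j : ℝ)) * (a j * (a (j + m) *
        (CB * (2 * ((2 : ℝ≥0∞) ^ (((j + m : ℤ) : ℝ) - 3) * Y ^ (1 / 2 : ℝ)))))) = K * (z j * x (j + m)) := by
      simp only [hK, hz, hx]
      have epow : (2 : ℝ≥0∞) ^ ((3 : ℝ) * (j : ℝ)) * (2 : ℝ≥0∞) ^ (((j + m : ℤ) : ℝ) - 3) =
          (2 : ℝ≥0∞) ^ ((m : ℝ) - 3) * (2 : ℝ≥0∞) ^ (-(3 / 2 : ℝ) * (m : ℝ)) *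
            ((2 : ℝ≥0∞) ^ ((5 / 2 : ℝ) * (j : ℝ)) * (2 : ℝ≥0∞) ^ ((3 / 2 : ℝ) * ((j + m : ℤ) : ℝ))) := by
        rw [← ENNReal.rpow_add _ _ h2 h2', ← ENNReal.rpow_add _ _ h2 h2', ← ENNReal.rpow_add _ _ h2 h2',
          ← ENNReal.rpow_add _ _ h2 h2']
        congr 1; push_cast; ring
      calc (2 : ℝ≥0∞) ^ ((3 : ℝ) * (j : ℝ)) * (a j * (a (j + m) *
            (CB * (2 * ((2 : ℝ≥0∞) ^ (((j + m : ℤ) : ℝ) - 3) * Y ^ (1 / 2 : ℝ))))))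
          = ((2 : ℝ≥0∞) ^ ((3 : ℝ) * (j : ℝ)) * (2 : ℝ≥0∞) ^ (((j + m : ℤ) : ℝ) - 3)) *
              (a j * a (j + m) * (CB * (2 * Y ^ (1 / 2 : ℝ)))) := by ring
        _ = _ := by rw [epow]; ring
    calc _ ≤ (2 : ℝ≥0∞) ^ ((3 : ℝ) * (j : ℝ)) * (a j * (a (j + m) *
            (CB * (2 * ((2 : ℝ≥0∞) ^ (((j + m : ℤ) : ℝ) - 3) * Y ^ (1 / 2 : ℝ)))))) := by gcongr
      _ = K * (z j * x (j + m)) := e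
  -- sum and Cauchy–Schwarz
  have hsum : ∑' j : ℤ, (2 : ℝ≥0∞) ^ ((3 : ℝ) * (j : ℝ)) *
      (a j * (a (j + m) * paraT (fun l' => (2 : ℝ≥0∞) ^ l' * s l') (j + m))) ≤ K * (D ^ (1 / 2 : ℝ) * Y ^ (1 / 2 : ℝ)) :=
    calc _ ≤ ∑' j : ℤ, K * (z j * x (j + m)) := ENNReal.tsum_le_tsum hterm
      _ = K * ∑' j : ℤ, z j * x (j + m) := ENNReal.tsum_mul_left
      _ ≤ K * (D ^ (1 / 2 : ℝ) * Y ^ (1 / 2 : ℝ)) := by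
          rw [← hz2, ← hx2]
          exact mul_le_mul' le_rfl (tsum_mul_shift_le z x m)
  refine hsum.trans ?_
  -- constants: `K · D^{1/2} Y^{1/2} = 2 CB · 2^{−3−m/2} · Y · D^{1/2} ≤ 2 CB Y D^{1/2}`
  have hYY : Y ^ (1 / 2 : ℝ) * Y ^ (1 / 2 : ℝ) = Y := by
    rw [← sq, ← ENNReal.rpow_natCast, ← ENNReal.rpow_mul]
    norm_num
  have hpow : (2 : ℝ≥0∞) ^ ((m : ℝ) - 3) * (2 : ℝ≥0∞) ^ (-(3 / 2 : ℝ) * (m : ℝ)) ≤ 1 := by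
    rw [← ENNReal.rpow_add _ _ h2 h2']
    have hm' : (-2 : ℝ) ≤ m := by exact_mod_cast hm
    calc (2 : ℝ≥0∞) ^ ((m : ℝ) - 3 + -(3 / 2 : ℝ) * (m : ℝ)) ≤ (2 : ℝ≥0∞) ^ (0 : ℝ) :=
          ENNReal.rpow_le_rpow_of_exponent_le (by norm_num) (by linarith)
      _ = 1 := ENNReal.rpow_zero
  calc K * (D ^ (1 / 2 : ℝ) * Y ^ (1 / 2 : ℝ))
      = 2 * CB * ((2 : ℝ≥0∞) ^ ((m : ℝ) - 3) * (2 : ℝ≥0∞) ^ (-(3 / 2 : ℝ) * (m : ℝ))) *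
          (Y ^ (1 / 2 : ℝ) * Y ^ (1 / 2 : ℝ)) * D ^ (1 / 2 : ℝ) := by rw [hK]; ring
    _ ≤ 2 * CB * 1 * (Y ^ (1 / 2 : ℝ) * Y ^ (1 / 2 : ℝ)) * D ^ (1 / 2 : ℝ) := by gcongr
    _ = 2 * CB * Y * D ^ (1 / 2 : ℝ) := by rw [hYY, mul_one]

/-- **The high–high (fine-pairs) sum at weight `8^j`**: with `s_l ≤ C_B 2^{3l/2} a_l`,
`∑_j 8^j s_j Q_j ≤ 2^{17} C_B · (∑_j 8^j a_j²) · (∑_j 32^j a_j²)^{1/2}`, `Q_j = paraQ2 a (2^· a) j` (reindex to the fine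
level, Cauchy–Schwarz over the coarse offsets `tsum_shift_le_sqrt` with `c = 3`, then `tsum_mul_shift_le`).
[cite: CheskidovZaya2016, Thm. 2.2 (proof)] -/
theorem highHigh_weighted_le (hB : ∀ l : ℤ, s l ≤ CB * (2 : ℝ≥0∞) ^ ((3 / 2 : ℝ) * (l : ℝ)) * a l) :
    ∑' j : ℤ, (2 : ℝ≥0∞) ^ ((3 : ℝ) * (j : ℝ)) * (s j * paraQ2 a (fun l => (2 : ℝ≥0∞) ^ l * a l) j) ≤
      2 ^ 17 * CB * (∑' j : ℤ, (2 : ℝ≥0∞) ^ ((3 : ℝ) * (j : ℝ)) * a j ^ 2) *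
        (∑' j : ℤ, (2 : ℝ≥0∞) ^ ((5 : ℝ) * (j : ℝ)) * a j ^ 2) ^ (1 / 2 : ℝ) := by
  have h2 : (2 : ℝ≥0∞) ≠ 0 := two_ne_zero
  have h2' : (2 : ℝ≥0∞) ≠ ⊤ := ENNReal.ofNat_ne_top
  set Y : ℝ≥0∞ := ∑' j : ℤ, (2 : ℝ≥0∞) ^ ((3 : ℝ) * (j : ℝ)) * a j ^ 2 with hY
  set D : ℝ≥0∞ := ∑' j : ℤ, (2 : ℝ≥0∞) ^ ((5 : ℝ) * (j : ℝ)) * a j ^ 2 with hD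
  set x : ℤ → ℝ≥0∞ := fun k => (2 : ℝ≥0∞) ^ ((3 / 2 : ℝ) * (k : ℝ)) * a k with hx
  set z : ℤ → ℝ≥0∞ := fun k => (2 : ℝ≥0∞) ^ ((5 / 2 : ℝ) * (k : ℝ)) * a k with hz
  have hx2 : ∑' k : ℤ, x k ^ 2 = Y := by
    refine tsum_congr fun k => ?_
    simp only [hx]
    rw [mul_pow, ← ENNReal.rpow_natCast ((2 : ℝ≥0∞) ^ _) 2, ← ENNReal.rpow_mul]
    congr 2; push_cast; ring
  have hz2 : ∑' k : ℤ, z k ^ 2 = D := by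
    refine tsum_congr fun k => ?_
    simp only [hz]
    rw [mul_pow, ← ENNReal.rpow_natCast ((2 : ℝ≥0∞) ^ _) 2, ← ENNReal.rpow_mul]
    congr 2; push_cast; ring
  -- the summand with `s_j ≤ CB x_j`, written as a finite sum over `m` of double sums
  set F : ℤ → ℤ → ℤ → ℝ≥0∞ := fun m j l =>
    (2 : ℝ≥0∞) ^ ((3 : ℝ) * (j : ℝ)) * x j * (a l * ((2 : ℝ≥0∞) ^ (l + m) * a (l + m))) with hF
  have hstep1 : ∑' j : ℤ, (2 : ℝ≥0∞) ^ ((3 : ℝ) * (j : ℝ)) * (s j * paraQ2 a (fun l => (2 : ℝ≥0∞) ^ l * a l) j) ≤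
      CB * ∑ m ∈ Finset.Icc (-2 : ℤ) 2, ∑' j : ℤ, ∑' n : ℕ, F m j (j - 4 + n) := by
    calc ∑' j : ℤ, (2 : ℝ≥0∞) ^ ((3 : ℝ) * (j : ℝ)) * (s j * paraQ2 a (fun l => (2 : ℝ≥0∞) ^ l * a l) j)
        ≤ ∑' j : ℤ, (2 : ℝ≥0∞) ^ ((3 : ℝ) * (j : ℝ)) * ((CB * x j) * paraQ2 a (fun l => (2 : ℝ≥0∞) ^ l * a l) j) := by
          refine ENNReal.tsum_le_tsum fun j => mul_le_mul' le_rfl (mul_le_mul' ?_ le_rfl)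
          simpa only [hx, mul_assoc] using hB j
      _ = CB * ∑' j : ℤ, ∑' n : ℕ, ∑ m ∈ Finset.Icc (-2 : ℤ) 2, F m j (j - 4 + n) := by
          rw [← ENNReal.tsum_mul_left]
          refine tsum_congr fun j => ?_
          have e : (2 : ℝ≥0∞) ^ ((3 : ℝ) * (j : ℝ)) * ((CB * x j) * paraQ2 a (fun l => (2 : ℝ≥0∞) ^ l * a l) j) =
              CB * (((2 : ℝ≥0∞) ^ ((3 : ℝ) * (j : ℝ)) * x j) * paraQ2 a (fun l => (2 : ℝ≥0∞) ^ l * a l) j) := by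
            ring
          rw [e]
          congr 1
          simp only [paraQ2]
          rw [← ENNReal.tsum_mul_left]
          refine tsum_congr fun n => ?_
          simp only [hF, Finset.mul_sum]
      _ = CB * ∑ m ∈ Finset.Icc (-2 : ℤ) 2, ∑' j : ℤ, ∑' n : ℕ, F m j (j - 4 + n) := by
          congr 1
          rw [← Summable.tsum_finsetSum (fun _ _ => ENNReal.summable)]
          refine tsum_congr fun j => ?_
          exact Summable.tsum_finsetSum (fun _ _ => ENNReal.summable)
  -- each `m`: reindex to the fine level `l` and bound
  have hm_bound : ∀ m ∈ Finset.Icc (-2 : ℤ) 2, ∑' j : ℤ, ∑' n : ℕ, F m j (j - 4 + n) ≤ 2 ^ 14 * Y * D ^ (1 / 2 : ℝ) := by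
    intro m hm
    rw [Finset.mem_Icc] at hm
    rw [tsum_tsum_reindex (F m)]
    -- inner sum in `n`: `∑_n 2^{3(l+4−n)} x_{l+4−n} = 2^{3(l+4)} ∑_n 2^{−3n} x_{l+4−n} ≤ 2^{3(l+4)} · 2 · Y^{1/2}`
    have hinner : ∀ l : ℤ, ∑' n : ℕ, (2 : ℝ≥0∞) ^ ((3 : ℝ) * (((l + 4 - n : ℤ)) : ℝ)) * x (l + 4 - n) ≤
        (2 : ℝ≥0∞) ^ ((3 : ℝ) * ((l : ℝ) + 4)) * (2 * Y ^ (1 / 2 : ℝ)) := by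
      intro l
      have hre : ∀ n : ℕ, (2 : ℝ≥0∞) ^ ((3 : ℝ) * (((l + 4 - n : ℤ)) : ℝ)) * x (l + 4 - n) =
          (2 : ℝ≥0∞) ^ ((3 : ℝ) * ((l : ℝ) + 4)) * ((2 : ℝ≥0∞) ^ (-(3 : ℝ) * (n : ℝ)) * x ((l + 4) - n)) := by
        intro n
        have hexp : (3 : ℝ) * (((l + 4 - n : ℤ)) : ℝ) = (3 : ℝ) * ((l : ℝ) + 4) + -(3 : ℝ) * (n : ℝ) := by
          push_cast
          ring
        rw [hexp, ENNReal.rpow_add _ _ h2 h2', mul_assoc]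
      rw [tsum_congr hre, ENNReal.tsum_mul_left]
      refine mul_le_mul' le_rfl ((tsum_shift_le_sqrt x (l + 4) (by norm_num : (0 : ℝ) ≤ 3)).trans ?_)
      rw [hx2]
      refine mul_le_mul' ?_ le_rfl
      -- `(∑ (2^{-3})^n)^{1/2} ≤ 2`
      have hG : (∑' n : ℕ, ((2 : ℝ≥0∞) ^ (-(3 : ℝ))) ^ n) ≤ 2 := by
        have h31 : (2 : ℝ≥0∞) ^ (-(3 : ℝ)) ≤ (2 : ℝ≥0∞) ^ (-(1 : ℝ)) :=
          ENNReal.rpow_le_rpow_of_exponent_le (by norm_num) (by norm_num)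
        calc (∑' n : ℕ, ((2 : ℝ≥0∞) ^ (-(3 : ℝ))) ^ n) ≤ ∑' n : ℕ, ((2 : ℝ≥0∞) ^ (-(1 : ℝ))) ^ n :=
              ENNReal.tsum_le_tsum fun n => pow_le_pow_left' h31 n
          _ = 2 := by rw [ENNReal.rpow_neg_one, ENNReal.tsum_geometric, ENNReal.one_sub_inv_two, inv_inv]
      calc (∑' n : ℕ, ((2 : ℝ≥0∞) ^ (-(3 : ℝ))) ^ n) ^ (1 / 2 : ℝ) ≤ (2 : ℝ≥0∞) ^ (1 / 2 : ℝ) :=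
            ENNReal.rpow_le_rpow hG (by norm_num)
        _ ≤ (2 : ℝ≥0∞) ^ (1 : ℝ) := ENNReal.rpow_le_rpow_of_exponent_le (by norm_num) (by norm_num)
        _ = 2 := ENNReal.rpow_one _
    -- rewrite the summand: `F m (l+4−n) l = [2^{3(l+4−n)} x_{l+4−n}] · (a_l 2^{l+m} a_{l+m})`
    have hsplit : ∀ l : ℤ, ∑' n : ℕ, F m (l + 4 - n) l =
        (∑' n : ℕ, (2 : ℝ≥0∞) ^ ((3 : ℝ) * (((l + 4 - n : ℤ)) : ℝ)) * x (l + 4 - n)) *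
          (a l * ((2 : ℝ≥0∞) ^ (l + m) * a (l + m))) := by
      intro l
      rw [← ENNReal.tsum_mul_right]
    -- the coefficient `a_l 2^{l+m} a_{l+m} 2^{3(l+4)} = 2^{12+m} 2^{−3m/2} z_l x_{l+m}`
    have hcoef : ∀ l : ℤ, (2 : ℝ≥0∞) ^ ((3 : ℝ) * ((l : ℝ) + 4)) * (a l * ((2 : ℝ≥0∞) ^ (l + m) * a (l + m))) =
        (2 : ℝ≥0∞) ^ ((12 : ℝ) + m) * (2 : ℝ≥0∞) ^ (-(3 / 2 : ℝ) * (m : ℝ)) * (z l * x (l + m)) := by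
      intro l
      simp only [hz, hx]
      rw [← ENNReal.rpow_intCast _ (l + m)]
      have epow : (2 : ℝ≥0∞) ^ ((3 : ℝ) * ((l : ℝ) + 4)) * (2 : ℝ≥0∞) ^ (((l + m : ℤ) : ℝ)) =
          (2 : ℝ≥0∞) ^ ((12 : ℝ) + m) * (2 : ℝ≥0∞) ^ (-(3 / 2 : ℝ) * (m : ℝ)) *
            ((2 : ℝ≥0∞) ^ ((5 / 2 : ℝ) * (l : ℝ)) * (2 : ℝ≥0∞) ^ ((3 / 2 : ℝ) * ((l + m : ℤ) : ℝ))) := by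
        rw [← ENNReal.rpow_add _ _ h2 h2', ← ENNReal.rpow_add _ _ h2 h2', ← ENNReal.rpow_add _ _ h2 h2',
          ← ENNReal.rpow_add _ _ h2 h2']
        congr 1; push_cast; ring
      calc (2 : ℝ≥0∞) ^ ((3 : ℝ) * ((l : ℝ) + 4)) * (a l * ((2 : ℝ≥0∞) ^ (((l + m : ℤ) : ℝ)) * a (l + m)))
          = ((2 : ℝ≥0∞) ^ ((3 : ℝ) * ((l : ℝ) + 4)) * (2 : ℝ≥0∞) ^ (((l + m : ℤ) : ℝ))) * (a l * a (l + m)) := by ring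
        _ = _ := by rw [epow]; ring
    have hpow : (2 : ℝ≥0∞) ^ ((12 : ℝ) + m) * (2 : ℝ≥0∞) ^ (-(3 / 2 : ℝ) * (m : ℝ)) ≤ 2 ^ 13 := by
      rw [← ENNReal.rpow_add _ _ h2 h2']
      have hm' : (-2 : ℝ) ≤ m := by exact_mod_cast hm.1
      calc (2 : ℝ≥0∞) ^ ((12 : ℝ) + m + -(3 / 2 : ℝ) * (m : ℝ)) ≤ (2 : ℝ≥0∞) ^ ((13 : ℕ) : ℝ) :=
            ENNReal.rpow_le_rpow_of_exponent_le (by norm_num) (by push_cast; linarith)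
        _ = 2 ^ 13 := ENNReal.rpow_natCast _ _
    have hYY : Y ^ (1 / 2 : ℝ) * Y ^ (1 / 2 : ℝ) = Y := by
      rw [← sq, ← ENNReal.rpow_natCast, ← ENNReal.rpow_mul]
      norm_num
    calc ∑' l : ℤ, ∑' n : ℕ, F m (l + 4 - n) l
        = ∑' l : ℤ, (∑' n : ℕ, (2 : ℝ≥0∞) ^ ((3 : ℝ) * (((l + 4 - n : ℤ)) : ℝ)) * x (l + 4 - n)) *
            (a l * ((2 : ℝ≥0∞) ^ (l + m) * a (l + m))) := tsum_congr hsplit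
      _ ≤ ∑' l : ℤ, ((2 : ℝ≥0∞) ^ ((3 : ℝ) * ((l : ℝ) + 4)) * (2 * Y ^ (1 / 2 : ℝ))) *
            (a l * ((2 : ℝ≥0∞) ^ (l + m) * a (l + m))) :=
          ENNReal.tsum_le_tsum fun l => mul_le_mul' (hinner l) le_rfl
      _ = ∑' l : ℤ, (2 * Y ^ (1 / 2 : ℝ)) * ((2 : ℝ≥0∞) ^ ((12 : ℝ) + m) * (2 : ℝ≥0∞) ^ (-(3 / 2 : ℝ) * (m : ℝ)) *
            (z l * x (l + m))) := by
          refine tsum_congr fun l => ?_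
          rw [← hcoef l]; ring
      _ = (2 * Y ^ (1 / 2 : ℝ)) * ((2 : ℝ≥0∞) ^ ((12 : ℝ) + m) * (2 : ℝ≥0∞) ^ (-(3 / 2 : ℝ) * (m : ℝ))) *
            ∑' l : ℤ, z l * x (l + m) := by
          rw [ENNReal.tsum_mul_left, ENNReal.tsum_mul_left]
          ring
      _ ≤ (2 * Y ^ (1 / 2 : ℝ)) * 2 ^ 13 * (D ^ (1 / 2 : ℝ) * Y ^ (1 / 2 : ℝ)) := by
          refine mul_le_mul' (mul_le_mul' le_rfl hpow) ?_
          rw [← hz2, ← hx2]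
          exact tsum_mul_shift_le z x m
      _ = 2 ^ 14 * (Y ^ (1 / 2 : ℝ) * Y ^ (1 / 2 : ℝ)) * D ^ (1 / 2 : ℝ) := by ring
      _ = 2 ^ 14 * Y * D ^ (1 / 2 : ℝ) := by rw [hYY]
  -- sum over the five offsets
  calc _ ≤ CB * ∑ m ∈ Finset.Icc (-2 : ℤ) 2, ∑' j : ℤ, ∑' n : ℕ, F m j (j - 4 + n) := hstep1
    _ ≤ CB * ∑ m ∈ Finset.Icc (-2 : ℤ) 2, 2 ^ 14 * Y * D ^ (1 / 2 : ℝ) := by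
        gcongr with m hm
        exact hm_bound m hm
    _ = CB * (5 * (2 ^ 14 * Y * D ^ (1 / 2 : ℝ))) := by
        rw [Finset.sum_const]
        simp
    _ ≤ 2 ^ 17 * CB * Y * D ^ (1 / 2 : ℝ) := by
        have h5 : (5 : ℝ≥0∞) * 2 ^ 14 ≤ 2 ^ 17 := by norm_num
        calc CB * (5 * (2 ^ 14 * Y * D ^ (1 / 2 : ℝ))) = (5 * 2 ^ 14) * CB * Y * D ^ (1 / 2 : ℝ) := by ring
          _ ≤ 2 ^ 17 * CB * Y * D ^ (1 / 2 : ℝ) := by gcongr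

/-- **THE RICCATI SUMMATION** (Cheskidov–Zaya 2016, Thm. 2.2, in the tree's low-mode shapes). For `a, s ≥ 0` on `ℤ`
with `s_l ≤ C_B 2^{3l/2} a_l`:
`∑_j 8^j (a_j ∑_{|m|≤2} a_{j+m} T_{j+m} + s_j Q_j) ≤ 2^{18} C_B · (∑_j 8^j a_j²) · (∑_j 32^j a_j²)^{1/2}`,
`T = paraT (2^· s)`, `Q = paraQ2 a (2^· a)` — the nonlinear side of the `8^j`-weighted block balance is controlled by
`y · D^{1/2}`, `y` the `Ḃ^{3/2}_{2,2}` row and `D` the dissipation row; by Young `y D^{1/2} ≤ ε D + y²/(4ε)` this is the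
summation behind `y' ≲ ν⁻¹ y²`. [cite: CheskidovZaya2016, Thm. 2.2 (proof)] [cite: CheskidovDai2015, §3.1 (3.6)] -/
theorem riccati_summation (hB : ∀ l : ℤ, s l ≤ CB * (2 : ℝ≥0∞) ^ ((3 / 2 : ℝ) * (l : ℝ)) * a l) :
    ∑' j : ℤ, (2 : ℝ≥0∞) ^ ((3 : ℝ) * (j : ℝ)) *
        (a j * ∑ m ∈ Finset.Icc (-2 : ℤ) 2, a (j + m) * paraT (fun l' => (2 : ℝ≥0∞) ^ l' * s l') (j + m) +
          s j * paraQ2 a (fun l => (2 : ℝ≥0∞) ^ l * a l) j) ≤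
      2 ^ 18 * CB * (∑' j : ℤ, (2 : ℝ≥0∞) ^ ((3 : ℝ) * (j : ℝ)) * a j ^ 2) *
        (∑' j : ℤ, (2 : ℝ≥0∞) ^ ((5 : ℝ) * (j : ℝ)) * a j ^ 2) ^ (1 / 2 : ℝ) := by
  set Y : ℝ≥0∞ := ∑' j : ℤ, (2 : ℝ≥0∞) ^ ((3 : ℝ) * (j : ℝ)) * a j ^ 2 with hY
  set D : ℝ≥0∞ := ∑' j : ℤ, (2 : ℝ≥0∞) ^ ((5 : ℝ) * (j : ℝ)) * a j ^ 2 with hD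
  set T := fun l' : ℤ => (2 : ℝ≥0∞) ^ l' * s l' with hT
  -- split the two channels
  have hsplit : ∑' j : ℤ, (2 : ℝ≥0∞) ^ ((3 : ℝ) * (j : ℝ)) *
      (a j * ∑ m ∈ Finset.Icc (-2 : ℤ) 2, a (j + m) * paraT T (j + m) + s j * paraQ2 a (fun l => (2 : ℝ≥0∞) ^ l * a l) j) =
      (∑ m ∈ Finset.Icc (-2 : ℤ) 2, ∑' j : ℤ, (2 : ℝ≥0∞) ^ ((3 : ℝ) * (j : ℝ)) * (a j * (a (j + m) * paraT T (j + m)))) +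
        ∑' j : ℤ, (2 : ℝ≥0∞) ^ ((3 : ℝ) * (j : ℝ)) * (s j * paraQ2 a (fun l => (2 : ℝ≥0∞) ^ l * a l) j) := by
    rw [← Summable.tsum_finsetSum (fun _ _ => ENNReal.summable), ← ENNReal.tsum_add]
    refine tsum_congr fun j => ?_
    rw [mul_add, Finset.mul_sum, Finset.mul_sum]
  rw [hsplit]
  have hL : ∑ m ∈ Finset.Icc (-2 : ℤ) 2, ∑' j : ℤ, (2 : ℝ≥0∞) ^ ((3 : ℝ) * (j : ℝ)) *
      (a j * (a (j + m) * paraT T (j + m))) ≤ ∑ m ∈ Finset.Icc (-2 : ℤ) 2, 2 * CB * Y * D ^ (1 / 2 : ℝ) := by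
    refine Finset.sum_le_sum fun m hm => ?_
    rw [Finset.mem_Icc] at hm
    exact lowHigh_weighted_le a s CB hB m hm.1
  have hH := highHigh_weighted_le a s CB hB
  calc _ ≤ (∑ m ∈ Finset.Icc (-2 : ℤ) 2, 2 * CB * Y * D ^ (1 / 2 : ℝ)) + 2 ^ 17 * CB * Y * D ^ (1 / 2 : ℝ) :=
        add_le_add hL hH
    _ = (5 * 2 + 2 ^ 17) * (CB * Y * D ^ (1 / 2 : ℝ)) := by
        rw [Finset.sum_const]
        simp
        ring
    _ ≤ 2 ^ 18 * (CB * Y * D ^ (1 / 2 : ℝ)) := by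
        gcongr
        norm_num
    _ = 2 ^ 18 * CB * Y * D ^ (1 / 2 : ℝ) := by ring

end Summit.NavierStokesRegularity.FluidComputer.RiccatiSummation

end
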